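import Mathlib
import Summits.ValiantsHypothesis.ValiantsHypothesis.Theorems.ElementaryWordLengthWordLengthQPIffEVH
import Literature.Computability.AlgebraicComplexity.CommutativeExtensionSimulation
import Literature.Computability.AlgebraicComplexity.StandardFamilies
import Literature.Computability.AlgebraicComplexity.StandardFamiliesProofs

/-!
# Crux `WordLengthQP` (stmt-ValiantsHypothesis-6623), line `positive-monoid-exits` —
stub `stub_realification`: quasi-polynomial complex words give quasi-polynomial real words

REALIFICATION of the crux: if for some `c` every transvection `E₀₂(per_n)` over `ℂ` is the
matrix of a word of at most `2^((log₂ n + c)^c)` affine elementary letters `E_ij(λ)`,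
`E_ij(λ·x_v)` (`λ ∈ ℂ`), then the same holds over `ℝ` (with a larger constant).  Route, through
tree theorems only:

* complex words ⟹ `PER ∈ VQP` over `ℂ`
  (`EpsOrderLadder.stub_isVQPFamily_perPoly_of_hasWords`, Ben-Or–Cleve divide and conquer);
* `L_ℝ(per_n) ≤ 68 · L_ℂ(per_n) + 6` (`complexity_perPoly_real_le`): the commutative case of
  Hrubeš–Yehudayoff 2011, Thm 4.2 (`CommExtSim.complexity_lmap_le`) for the `ℝ`-basis `{1, i}` of
  `ℂ` (`Complex.basisOneI`) and the functional `re` (`Complex.reLm`), since `re` applied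
  coefficientwise to `per_n ∈ ℂ[x]` is `per_n ∈ ℝ[x]` (`lmap_reLm_perPoly`, from `map_perPoly`);
  hence `PER ∈ VQP` over `ℝ` (`isVQPFamily_perPoly_real_of_complex`);
* `VQP ⊆ VQF` in word form over ANY commutative ring (`vqpWordQp_of_isVQPFamily`, the proof of
  `EpsOrderLadder.stub_vqpWordQp` verbatim: `VpWordQp.hasWordAt_of_complexity_le` — the
  VSBR/Hyafil stage recursion with the Ben-Or–Cleve word algebra — and the exponent bookkeeping
  `EpsOrderLadder.exp_bound_vqp_to_word`).

References: [HrubesYehudayoff2011] Thm 4.2; [BenOrCleve1992] Thm 1;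
[BurgisserClausenShokrollahi1997] Thm (21.33), (21.36), Cor (21.40).
-/

-- `Summit.ValiantsHypothesis.ValiantsHypothesis.…` is the tree's mandated single-conjunct layout
-- (Sub = Summit), so the duplicated namespace component is intended.
set_option linter.dupNamespace false

noncomputable section

namespace Summit.ValiantsHypothesis.ValiantsHypothesis.Cruxes.WordLengthQP.PositiveMonoidExits

open Literature.Computability.AlgebraicComplexity

/-! ### `VQP ⊆ VQF` in word form, over any commutative ring -/

/-- **`VQP` families have quasi-polynomial affine elementary words, over any commutative ring**:
for every `VQP` family `f` over `k` there is `c` such that for every `n` the transvection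
`E₁₃(fₙ)` is the matrix of a word of at most `2^{(log₂ n + c)^c}` letters `E_{ij}(λ)`,
`E_{ij}(λ·x_s)` (`i ≠ j`).  The proof of `EpsOrderLadder.stub_vqpWordQp` (stated there over `ℂ`)
verbatim: `VpWordQp.hasWordAt_of_complexity_le` with `deg fₙ, #σₙ + 1 < 2^{(log₂ n + 1)A}`,
`L(fₙ) ≤ 2^{(log₂ n + c)^c}`, `E = (log₂ n + 1)A + (log₂ n + c)^c`, length
`≤ 2^{23E²} ≤ 2^{(log₂ n + c')^{c'}}`, `c' = 2c + 23(A+1)² + 3`.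
[cite: BurgisserClausenShokrollahi1997, Thm. (21.36) and (21.40); BenOrCleve1992, Thm. 1] -/
theorem vqpWordQp_of_isVQPFamily {k : Type*} [CommRing k] {σ : ℕ → Type} [∀ n, Fintype (σ n)]
    (f : ∀ n, MvPolynomial (σ n) k) (hf : IsVQPFamily f) :
    ∃ c : ℕ, ∀ n : ℕ, ∃ w : List (Fin 3 × Fin 3 × k × Option (σ n)),
      w.length ≤ 2 ^ ((Nat.log 2 n + c) ^ c) ∧ (∀ l ∈ w, l.1 ≠ l.2.1) ∧
      (w.map (fun l => Matrix.transvection l.1 l.2.1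
        (MvPolynomial.C l.2.2.1 * l.2.2.2.elim 1 MvPolynomial.X))).prod =
        Matrix.transvection (0 : Fin 3) 2 (f n) := by
  obtain ⟨⟨hvarp, hdegp⟩, ⟨c, hc⟩⟩ := hf
  obtain ⟨A₁, hA₁, hdeg⟩ := IsPBounded.exists_lt_two_pow hdegp
  obtain ⟨A₃, -, hV⟩ := IsPBounded.exists_lt_two_pow hvarp
  set A := A₁ + A₃ with hA
  refine ⟨2 * c + 23 * (A + 1) ^ 2 + 3, fun n => ?_⟩
  set ℓ := Nat.log 2 n with hℓ
  set E := (ℓ + 1) * A + (ℓ + c) ^ c with hE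
  have hA1' : 1 ≤ (ℓ + 1) * A :=
    Nat.one_le_iff_ne_zero.2 (Nat.mul_ne_zero (by omega) (by omega))
  have hE1 : 1 ≤ E := le_add_right hA1'
  have hEd : (ℓ + 1) * A₁ ≤ E := (Nat.mul_le_mul_left _ (by omega)).trans (Nat.le_add_right _ _)
  have hEV : (ℓ + 1) * A₃ ≤ E := (Nat.mul_le_mul_left _ (by omega)).trans (Nat.le_add_right _ _)
  have hd : (f n).totalDegree < 2 ^ E :=
    (hdeg n).trans_le (Nat.pow_le_pow_right (by norm_num) hEd)
  have hL : complexity (f n) ≤ 2 ^ E :=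
    (hc n).trans (Nat.pow_le_pow_right (by norm_num) (Nat.le_add_left _ _))
  have hv : Fintype.card (σ n) + 1 ≤ 2 ^ E :=
    (hV n).trans_le (Nat.pow_le_pow_right (by norm_num) hEV)
  obtain ⟨w, hw, ho, hp⟩ :=
    Summit.ValiantsHypothesis.ValiantsHypothesis.Theorems.VpWordQp.hasWordAt_of_complexity_le
      le_rfl hd hL hv hE1 (0 : Fin 3) 2 (by decide)
  exact ⟨w, hw.trans (Nat.pow_le_pow_right (by norm_num)
    (EpsOrderLadder.exp_bound_vqp_to_word ℓ c A)), ho, hp⟩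

/-! ### Realification of circuit complexity for the permanent -/

/-- The real part, applied coefficientwise to the generic permanent over `ℂ`, is the generic
permanent over `ℝ` (its coefficients are real: `per_n^ℂ = map ofReal per_n^ℝ`, `map_perPoly`).
[folklore] -/
theorem lmap_reLm_perPoly (n : ℕ) :
    CommExtSim.lmap Complex.reLm (perPoly (Fin n) ℂ) = perPoly (Fin n) ℝ := by
  ext m
  rw [CommExtSim.coeff_lmap, ← map_perPoly (n := Fin n) (algebraMap ℝ ℂ), MvPolynomial.coeff_map]
  simp

/-- **Realification of complexity** (Hrubeš–Yehudayoff 2011, Thm 4.2, commutative case, for the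
extension `ℂ/ℝ` of dimension `2`): `L_ℝ(per_n) ≤ 68 · L_ℂ(per_n) + 6`
(`5·2³ + 6·2² + 2·2 = 68`, `3·2 = 6`). [cite: HrubesYehudayoff2011, Thm 4.2] -/
theorem complexity_perPoly_real_le (n : ℕ) :
    complexity (perPoly (Fin n) ℝ) ≤ 68 * complexity (perPoly (Fin n) ℂ) + 6 := by
  have h := CommExtSim.complexity_lmap_le (σ := Fin n × Fin n) Complex.basisOneI Complex.reLm
    (perPoly (Fin n) ℂ)
  rw [lmap_reLm_perPoly] at h
  simpa using h

/-- **`PER ∈ VQP` over `ℂ` implies `PER ∈ VQP` over `ℝ`**: `L_ℝ(per_n) ≤ 68 · 2^e + 6 ≤ 2^{e+7}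
≤ 2^{(log₂ n + (c + 11))^{c + 11}}` for `e = (log₂ n + c)^c`
(`EpsOrderLadder.exp_bound_word_to_vqp`). [cite: HrubesYehudayoff2011, Thm 4.2] -/
theorem isVQPFamily_perPoly_real_of_complex (h : IsVQPFamily (fun n => perPoly (Fin n) ℂ)) :
    IsVQPFamily (fun n => perPoly (Fin n) ℝ) := by
  obtain ⟨-, c, hc⟩ := h
  refine ⟨isPFamily_perPoly_holds, c + 11, fun n => ?_⟩
  set ℓ := Nat.log 2 n with hℓ
  set e := (ℓ + c) ^ c with he
  have hC : complexity (perPoly (Fin n) ℂ) ≤ 2 ^ e := hc n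
  have h1 : 68 * 2 ^ e + 6 ≤ 2 ^ (e + 7) := by
    have := Nat.one_le_two_pow (n := e)
    rw [pow_add]
    omega
  have h2 : e + 7 ≤ 3 * e + 8 := by omega
  calc complexity (perPoly (Fin n) ℝ) ≤ 68 * complexity (perPoly (Fin n) ℂ) + 6 :=
        complexity_perPoly_real_le n
    _ ≤ 68 * 2 ^ e + 6 := by omega
    _ ≤ 2 ^ (e + 7) := h1
    _ ≤ 2 ^ (3 * e + 8) := Nat.pow_le_pow_right (by norm_num) h2
    _ ≤ 2 ^ ((ℓ + (c + 11)) ^ (c + 11)) :=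
        Nat.pow_le_pow_right (by norm_num) (EpsOrderLadder.exp_bound_word_to_vqp ℓ c)

/-! ### The registered stub -/

/-- **Realification** (stub `stub_realification` of line `positive-monoid-exits`): quasi-polynomial
complex words for `E₀₂(per_n)` give quasi-polynomial real words.  Route: complex words ⟹
`IsVQPFamily (perPoly · ℂ)` (`EpsOrderLadder.stub_isVQPFamily_perPoly_of_hasWords`) ⟹
`IsVQPFamily (perPoly · ℝ)` (`isVQPFamily_perPoly_real_of_complex`: `L_ℝ(per_n) ≤ 68 L_ℂ(per_n) + 6`
by `CommExtSim.complexity_lmap_le` for the `ℝ`-basis `Complex.basisOneI` and `φ = Complex.reLm`,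
`lmap re (perPoly _ ℂ) = perPoly _ ℝ` by `map_perPoly`) ⟹ real words of length `2^{23E²}`
(`vqpWordQp_of_isVQPFamily`, i.e. `VpWordQp.hasWordAt_of_complexity_le` over `ℝ`).
[cite: HrubesYehudayoff2011, Thm 4.2; BenOrCleve1992, Thm 1;
BurgisserClausenShokrollahi1997, (21.33), (21.40)] -/
theorem stub_realification :
    (∃ c : ℕ, ∀ n : ℕ, ∃ w : List (Fin 3 × Fin 3 × ℂ × Option (Fin n × Fin n)),
      w.length ≤ 2 ^ ((Nat.log 2 n + c) ^ c) ∧ (∀ l ∈ w, l.1 ≠ l.2.1) ∧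
      (w.map (fun l => Matrix.transvection l.1 l.2.1
        (MvPolynomial.C l.2.2.1 * l.2.2.2.elim 1 MvPolynomial.X))).prod =
        Matrix.transvection (0 : Fin 3) 2 (perPoly (Fin n) ℂ)) →
    ∃ c : ℕ, ∀ n : ℕ, ∃ w : List (Fin 3 × Fin 3 × ℝ × Option (Fin n × Fin n)),
      w.length ≤ 2 ^ ((Nat.log 2 n + c) ^ c) ∧ (∀ l ∈ w, l.1 ≠ l.2.1) ∧
      (w.map (fun l => Matrix.transvection l.1 l.2.1
        (MvPolynomial.C l.2.2.1 * l.2.2.2.elim 1 MvPolynomial.X))).prod =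
        Matrix.transvection (0 : Fin 3) 2 (perPoly (Fin n) ℝ) := fun h =>
  vqpWordQp_of_isVQPFamily (fun n => perPoly (Fin n) ℝ)
    (isVQPFamily_perPoly_real_of_complex (EpsOrderLadder.stub_isVQPFamily_perPoly_of_hasWords h))

end Summit.ValiantsHypothesis.ValiantsHypothesis.Cruxes.WordLengthQP.PositiveMonoidExits

end
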